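import Mathlib
import Summits.ResolutionOfSingularities.ResolutionOfSingularities.Theorems.FrobeniusClosingSteerRadicandChainRealisation
import Literature.AlgebraicGeometry.Resolution.RegularLocalRingsProofs
import HarnessLib

/-!
# Crux `Steer` (stmt-ResolutionOfSingularities-16345), chain W4.1, K(3) ↦ CP2019 debt: PRELIMINARIES for the bridge
# `CossartPiltant2019LocalPermissibleSing → CossartPiltant2019HironakaLUIsolatedBranch`

OURS (campaign `res-hironaka`, rung L ★L-G4, slot W4.1, seat `res-type-026`; res-L0-w41-plan-1 RULING 2
2026-08-27T07:20:27Z; NOT a statement of the manuscript under review; AI review is weaker than expert review).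
Theses-free helpers for `Theorems/FrobeniusClosingSteerHironakaLUIsolatedBranchOfCP.lean`:

* `HironakaLUBranchOfCP.locAtCentre_eq_self_of_subringDominates` — a local subring dominated by `O` is its own
  localisation at the centre; `charP_residueField_subring`; `isolated_of_ringEquiv` (isolated singularity is
  invariant under `≃+*`); `exists_valuationSubring_dominates` (Chevalley along a branch of local subrings —
  res-L0-w41-lead-1's lemma of `…NoEternalChainThree.lean`, made universe-polymorphic);
* `RadicandChainRealisation.isQuadraticTransform_realR_of_isLocalRing` — res-L1-type-o8's quadratic-transform law
  of the realisation layer (`…RadicandChainRealisationQT.lean`, p504919) with the cleaning binder `hmult`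
  (used there only to install the locality instances of the germs) replaced by those instances, so that it runs on
  the binders of `CossartPiltant2019HironakaLUIsolatedBranch`, which carry no cleaning hypothesis (locality there
  comes from `f i − (θ i)^p = (u i)^p · f (i+1) ∈ 𝔪_i`).
[cite: Cutkosky2014, §2.1–2.2] [cite: Matsumura1987, Thm. 10.2] [folklore]
-/

noncomputable section

-- `Summit.<S>.<S>.…` duplicates the summit name by design (single-problem summit).
set_option linter.dupNamespace false

open Polynomial IsLocalRing

namespace Summit.ResolutionOfSingularities.ResolutionOfSingularities.Theorems.SwitchingDichotomy

open Literature.AlgebraicGeometry.Resolution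

universe u

/-! ## (0) General lemmas -/

namespace HironakaLUBranchOfCP

section General

variable {K : Type u} [Field K]

/-- A local subring of `K` dominated by the valuation ring `O` is its own localisation at the centre of `O`:
`locAtCentre B O = B`. [cite: NovacoskiSpivakovsky2014, Def. 2.8] [folklore] -/
theorem locAtCentre_eq_self_of_subringDominates {B : Subring K} [IsLocalRing B] {O : ValuationSubring K}
    (h : SubringDominates B O.toSubring) : locAtCentre B O = B := by
  refine le_antisymm ?_ (le_locAtCentre B O)
  rintro _ ⟨y, hy, z, hz, hv, rfl⟩
  have hzO : z⁻¹ ∈ O := by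
    rw [← O.valuation_le_one_iff, map_inv₀, hv, inv_one]
  have hzinv : z⁻¹ ∈ B := h.2 z hz hzO
  rw [div_eq_mul_inv]
  exact B.mul_mem hy hzinv

/-- The residue field of a local subring of a field of characteristic `p` has characteristic `p`. [folklore] -/
theorem charP_residueField_subring (p : ℕ) [Fact p.Prime] [CharP K p] (B : Subring K) [IsLocalRing B] :
    CharP (ResidueField B) p := by
  have h0 : ((p : ℕ) : ResidueField B) = 0 := by
    have : ((p : ℕ) : B) = 0 := by exact_mod_cast (CharP.cast_eq_zero B p)
    rw [← map_natCast (IsLocalRing.residue B) p, this, map_zero]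
  exact (CharP.charP_iff_prime_eq_zero Fact.out).mpr h0

/-- **Isolated singularity is invariant under ring isomorphisms**: if every non-maximal prime of `A` has a regular
local ring, so does every non-maximal prime of `B ≅ A`. [folklore] -/
theorem isolated_of_ringEquiv {A B : Type u} [CommRing A] [CommRing B] (e : A ≃+* B)
    (hA : ∀ (P : Ideal A) [P.IsPrime], (∃ Q : Ideal A, Q.IsPrime ∧ P < Q) →
      IsRegularLocalRing (Localization.AtPrime P))
    (P : Ideal B) [P.IsPrime] (hP : ∃ Q : Ideal B, Q.IsPrime ∧ P < Q) :
    IsRegularLocalRing (Localization.AtPrime P) := by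
  obtain ⟨Q, hQ, hPQ⟩ := hP
  let P' : Ideal A := P.comap e.toRingHom
  haveI : P'.IsPrime := Ideal.comap_isPrime _ _
  have hlt : P' < Q.comap e.toRingHom := by
    refine lt_of_le_of_ne (Ideal.comap_mono hPQ.le) fun heq => hPQ.ne ?_
    exact Ideal.comap_injective_of_surjective e.toRingHom e.surjective heq
  haveI := hA P' ⟨Q.comap e.toRingHom, Ideal.comap_isPrime _ _, hlt⟩
  -- `A_{P'} ≃ B_P`
  have hmap : P'.primeCompl.map e.toRingHom.toMonoidHom = P.primeCompl := by
    ext b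
    simp only [Submonoid.mem_map, Ideal.mem_primeCompl_iff]
    constructor
    · rintro ⟨a, ha, rfl⟩
      exact fun hb => ha (Ideal.mem_comap.mpr hb)
    · intro hb
      refine ⟨e.symm b, fun ha => hb ?_, by simp⟩
      have ha' : e.toRingHom (e.symm b) ∈ P := Ideal.mem_comap.mp ha
      simpa using ha'
  let eP : Localization.AtPrime P' ≃+* Localization.AtPrime P :=
    IsLocalization.ringEquivOfRingEquiv (Localization.AtPrime P') (Localization.AtPrime P) e hmap
  exact IsRegularLocalRing.of_ringEquiv eP

-- adapted from Theorems/FrobeniusClosingSteerNoEternalChainThree.lean (res-L0-w41-lead-1, p509311), where the same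
-- statement is proved for fields in `Type`; here universe-polymorphic, proof verbatim.
/-- **Chevalley along a branch**: for a sequence of LOCAL subrings `S m` of a field, each dominating the previous
one, some valuation ring of the field dominates every member. [cite: Matsumura1987, Thm. 10.2] [folklore] -/
theorem exists_valuationSubring_dominates (S : ℕ → Subring K) [∀ m, IsLocalRing (S m)]
    (hdom : ∀ m, SubringDominates (S m) (S (m + 1))) :
    ∃ O : ValuationSubring K, ∀ m, SubringDominates (S m) O.toSubring := by
  classical
  have hmono : Monotone S := monotone_nat_of_le_succ fun m => (hdom m).1
  have hdir : Directed (· ≤ ·) S := hmono.directed_le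
  have hdomle : ∀ {m n : ℕ}, m ≤ n → SubringDominates (S m) (S n) := by
    intro m n hmn
    induction hmn with
    | refl => exact SubringDominates.refl _
    | step _ ih => exact ih.trans (hdom _)
  set U : Subring K := ⨆ m, S m with hU
  have hSU : ∀ m, S m ≤ U := fun m => le_iSup S m
  have hmem : ∀ {z : K}, z ∈ U → ∃ m, z ∈ S m := fun hz => (Subring.mem_iSup_of_directed hdir).mp hz
  -- a unit of `U` lying in `S m` is a unit of `S m`
  have hunit : ∀ m (a : S m), IsUnit (Subring.inclusion (hSU m) a) → IsUnit a := by
    intro m a ha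
    rw [isUnit_subring_iff_inv_mem] at ha ⊢
    refine ⟨ha.1, ?_⟩
    obtain ⟨n, hn⟩ := hmem ha.2
    exact (hdomle (le_max_left m n)).2 _ a.2 ((hmono (le_max_right m n)) hn)
  -- `U` is local
  haveI hUloc : IsLocalRing U := by
    refine ⟨fun {a b} hab => ?_⟩
    obtain ⟨m, hm⟩ := hmem a.2
    obtain ⟨n, hn⟩ := hmem b.2
    have ha' : (a : K) ∈ S (max m n) := hmono (le_max_left m n) hm
    have hb' : (b : K) ∈ S (max m n) := hmono (le_max_right m n) hn
    have hab' : (⟨(a : K), ha'⟩ : S (max m n)) + ⟨(b : K), hb'⟩ = 1 :=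
      Subtype.ext (by simpa using congrArg Subtype.val hab)
    have ea : Subring.inclusion (hSU (max m n)) ⟨(a : K), ha'⟩ = a := Subtype.ext rfl
    have eb : Subring.inclusion (hSU (max m n)) ⟨(b : K), hb'⟩ = b := Subtype.ext rfl
    rcases IsLocalRing.isUnit_or_isUnit_of_add_one hab' with h | h
    · exact Or.inl (ea ▸ h.map (Subring.inclusion (hSU (max m n))))
    · exact Or.inr (eb ▸ h.map (Subring.inclusion (hSU (max m n))))
  obtain ⟨B, hB⟩ := (LocalSubring.mk U).exists_le_valuationSubring
  refine ⟨B, fun m => ?_⟩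
  have hmU : LocalSubring.mk (S m) ≤ LocalSubring.mk U := ⟨hSU m, ⟨fun a ha => hunit m a ha⟩⟩
  haveI : IsLocalRing B.toSubring := inferInstanceAs (IsLocalRing B)
  exact (subringDominates_iff (S m) B.toSubring).mpr (hmU.trans hB)

end General

end HironakaLUBranchOfCP

/-! ## (1) The quadratic-transform law of the realisation layer without the cleaning binder -/

namespace RadicandChainRealisation

section QT

variable (p : ℕ) [hp : Fact p.Prime] {L : Type u} [Field L] (S : ℕ → Subring L)
variable [∀ m, IsLocalRing (S m)] (f : ∀ m, S m)
variable [Fact (Irreducible (radPoly p S f))] (g : ∀ m, S m) (x : ∀ m, S (m + 1))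
variable (hθ : ∀ m, theta p S f g x m ^ p = emb p S f m (f m))

-- adapted from Theorems/FrobeniusClosingSteerRadicandChainRealisationQT.lean (res-L1-type-o8, p504919):
-- VERBATIM proof of `isQuadraticTransform_realR` with the binder `hmult` (used there only to install the two
-- locality instances) replaced by the instances themselves.
/-- **`R (m+1)` is a quadratic transform of `R m`** along `x'`, the parameter of the quadratic transform
`S m → S (m+1)` — the law of `isQuadraticTransform_realR` with the locality of the germs as INSTANCES instead of
the cleaning binder `hmult` (which its proof used for nothing else). [cite: Cutkosky2014, §2.1] [folklore] -/
theorem isQuadraticTransform_realR_of_isLocalRing [CharP L p]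
    [∀ m, IsLocalRing (AdjoinRoot ((X : (S m)[X]) ^ p - C (f m)))] [∀ m, IsLocalRing (realR p S f g x hθ m)] (hle : ∀ m, S m ≤ S (m + 1)) (hx0 : ∀ m, (x m : L) ≠ 0) (m : ℕ)
    (hinj : ∀ m, Function.Injective (phi p S f g x hθ m))
    (hQT : IsQuadraticTransform (S m) (S (m + 1)))
    (hspan : Ideal.span ((fun y : S m => (⟨(y : L), hle m y.2⟩ : S (m + 1))) ''
        (maximalIdeal (S m) : Set (S m))) = Ideal.span {x m})
    (hrel : ((f (m + 1) : S (m + 1)) : L) * ((x m : S (m + 1)) : L) ^ p =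
      ((f m : S m) : L) - ((g m : S m) : L) ^ p) :
    IsQuadraticTransform (realR p S f g x hθ m) (realR p S f g x hθ (m + 1)) := by
  obtain ⟨_, x', hx'𝔪, hx'0, _, hbl, hfrac, hdom⟩ := hQT
  have hx'0L : (x' : L) ≠ 0 := fun e => hx'0 (Subtype.ext e)
  obtain ⟨s', s'', hxs', -, hss, -⟩ := exists_unit_ratio (hle m) hx'𝔪 hx'0L hbl hspan
  -- `x m ∈ 𝔪_{m+1}` and `f m − (g m)^p ∈ 𝔪_m`
  have hxm𝔪 : x m ∈ maximalIdeal (S (m + 1)) := by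
    have : x m ∈ Ideal.span {x m} := Ideal.mem_span_singleton_self _
    rw [← hspan] at this
    refine (Ideal.span_le.mpr ?_) this
    rintro _ ⟨y, hy, rfl⟩
    exact NoEternalChainOne.inclusion_mem_maximalIdeal_of_subringDominates hdom hy
  have hfg : f m - g m ^ p ∈ maximalIdeal (S m) := by
    apply mem_maximalIdeal_of_inclusion_mem (hle m)
    have : (⟨((f m - g m ^ p : S m) : L), hle m (f m - g m ^ p).2⟩ : S (m + 1)) = f (m + 1) * x m ^ p :=
      Subtype.ext (by push_cast; exact (hrel).symm)
    rw [this]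
    exact Ideal.mul_mem_left _ _ (Ideal.pow_mem_of_mem _ hxm𝔪 _ hp.out.pos)
  -- the parameter, seen in `R m`
  set ξ : realR p S f g x hθ m := ⟨emb p S f m x', emb_mem_realR p S f g x hθ m x'⟩ with hξ
  have hξ𝔪 : ξ ∈ maximalIdeal (realR p S f g x hθ m) := emb_mem_maximalIdeal_realR p S f g x hθ m (hinj m) hx'𝔪
  have hξ0 : (ξ : AdjoinRoot (radPoly p S f)) ≠ 0 := fun h0 => hx'0L (by
    have := emb_injective p S f m (h0.trans (map_zero _).symm); simp [this])
  have hξ' : (ξ : AdjoinRoot (radPoly p S f)) = emb p S f (m + 1) ⟨(x' : L), hle m x'.2⟩ :=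
    emb_eq_of_coe_eq p S f rfl
  have hRR : realR p S f g x hθ m ≤ realR p S f g x hθ (m + 1) := realR_le_succ p S f g x hθ hle hx0 m
  -- `θ m − g m = emb (x m) · θ (m+1)`, `emb (x m) = emb s' · ξ`, so `(θ m − g m)/ξ = emb s' · θ (m+1)`
  have hxm_eq : emb p S f (m + 1) (x m) =
      emb p S f (m + 1) s' * (ξ : AdjoinRoot (radPoly p S f)) := by
    rw [hξ', ← map_mul]
    exact emb_eq_of_coe_eq p S f (by simp [hxs'])
  have hθsub : theta p S f g x m - emb p S f m (g m) =
      emb p S f (m + 1) (x m) * theta p S f g x (m + 1) := by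
    rw [theta_eq_succ p S f g x hx0 m]; ring
  have hθdiv : (theta p S f g x m - emb p S f m (g m)) / (ξ : AdjoinRoot (radPoly p S f)) =
      emb p S f (m + 1) s' * theta p S f g x (m + 1) := by
    rw [hθsub, hxm_eq, mul_assoc, mul_comm (ξ : AdjoinRoot (radPoly p S f)), ← mul_assoc,
      mul_div_cancel_right₀ _ hξ0]
  -- (a) `R m[𝔑_m/ξ] ⊆ R (m+1)`
  have hBl : blowupRing (realR p S f g x hθ m) (ξ : AdjoinRoot (radPoly p S f)) ≤
      realR p S f g x hθ (m + 1) := by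
    let J : Ideal (realR p S f g x hθ m) :=
      { carrier := {y | (y : AdjoinRoot (radPoly p S f)) / ξ ∈ realR p S f g x hθ (m + 1)}
        add_mem' := fun {a b} ha hb => by
          simp only [Set.mem_setOf_eq, Subring.coe_add, add_div] at ha hb ⊢
          exact add_mem ha hb
        zero_mem' := by
          simp only [Set.mem_setOf_eq, ZeroMemClass.coe_zero, zero_div]
          exact zero_mem _
        smul_mem' := fun c {y} hy => by
          simp only [Set.mem_setOf_eq, smul_eq_mul, Subring.coe_mul, mul_div_assoc] at hy ⊢
          exact mul_mem (hRR c.2) hy }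
    have hJ : maximalIdeal (realR p S f g x hθ m) ≤ J := by
      refine maximalIdeal_realR_le p S f g x hθ m (hinj m) hfg ?_ ?_
      · show (theta p S f g x m - emb p S f m (g m)) / (ξ : AdjoinRoot (radPoly p S f)) ∈
          realR p S f g x hθ (m + 1)
        rw [hθdiv]
        exact mul_mem (emb_mem_realR p S f g x hθ (m + 1) s') (theta_mem_realR p S f g x hθ (m + 1))
      · intro s hs
        show emb p S f m s / (ξ : AdjoinRoot (radPoly p S f)) ∈ realR p S f g x hθ (m + 1)
        rw [← emb_div_eq p S f hle m hx'0L (hbl (div_mem_blowupRing _ hs))]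
        exact emb_mem_realR p S f g x hθ (m + 1) _
    unfold blowupRing
    refine Subring.closure_le.mpr ?_
    rintro z (hz | ⟨y, hy, rfl⟩)
    · exact hRR hz
    · exact hJ hy
  -- (b) every element of `R (m+1)` is a fraction over `R m[𝔑_m/ξ]` with denominator a unit of `R (m+1)`
  have hS : ∀ s : S (m + 1), emb p S f (m + 1) s ∈
      fracSubring (blowupRing (realR p S f g x hθ m) (ξ : AdjoinRoot (radPoly p S f))) (realR p S f g x hθ (m + 1)) := by
    intro s
    obtain ⟨a, ha, b, hb, hbi, hs⟩ := hfrac (s : L) s.2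
    by_cases hb0 : b = 0
    · have : s = 0 := Subtype.ext (by rw [hs, hb0, div_zero]; rfl)
      rw [this, map_zero]; exact zero_mem _
    have hb0' : emb p S f (m + 1) ⟨b, hbl hb⟩ ≠ 0 := fun h0 => hb0 (by
      have := emb_injective p S f (m + 1) (h0.trans (map_zero _).symm)
      simpa using congrArg Subtype.val this)
    refine ⟨emb p S f (m + 1) ⟨a, hbl ha⟩, emb_mem_blowupRing_of_mem p S f g x hθ hle m (hinj m) hx'0L hbl ha,
      emb p S f (m + 1) ⟨b, hbl hb⟩, emb_mem_blowupRing_of_mem p S f g x hθ hle m (hinj m) hx'0L hbl hb,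
      hb0', ?_, ?_⟩
    · have : (emb p S f (m + 1) ⟨b, hbl hb⟩)⁻¹ = emb p S f (m + 1) ⟨b⁻¹, hbi⟩ := by
        symm
        apply eq_inv_of_mul_eq_one_left
        rw [← map_mul, ← map_one (emb p S f (m + 1))]
        exact congrArg _ (Subtype.ext (by simp [inv_mul_cancel₀ hb0]))
      rw [this]
      exact emb_mem_realR p S f g x hθ (m + 1) _
    · rw [eq_div_iff hb0', ← map_mul]
      exact congrArg _ (Subtype.ext (by simp [hs, div_mul_cancel₀ _ hb0]))
  have hθ' : theta p S f g x (m + 1) ∈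
      fracSubring (blowupRing (realR p S f g x hθ m) (ξ : AdjoinRoot (radPoly p S f))) (realR p S f g x hθ (m + 1)) := by
    have : theta p S f g x (m + 1) =
        (theta p S f g x m - emb p S f m (g m)) / (ξ : AdjoinRoot (radPoly p S f)) * emb p S f (m + 1) s'' := by
      rw [hθdiv, mul_assoc, mul_comm (theta p S f g x (m + 1)), ← mul_assoc, ← map_mul, hss, map_one, one_mul]
    rw [this]
    refine mul_mem (le_fracSubring _ _ ?_) (hS s'')
    exact div_mem_blowupRing (R := realR p S f g x hθ m) _
      (theta_sub_mem_maximalIdeal_realR p S f g x hθ m (hinj m) hfg)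
  have hFr : realR p S f g x hθ (m + 1) ≤
      fracSubring (blowupRing (realR p S f g x hθ m) (ξ : AdjoinRoot (radPoly p S f))) (realR p S f g x hθ (m + 1)) :=
    lift_range_le _ _ hS hθ'
  -- (c) domination: `𝔑_m ⊆ 𝔑_{m+1}`
  have hle𝔪 : maximalIdeal (realR p S f g x hθ m) ≤
      (maximalIdeal (realR p S f g x hθ (m + 1))).comap (Subring.inclusion hRR) := by
    refine maximalIdeal_realR_le p S f g x hθ m (hinj m) hfg ?_ ?_
    · rw [Ideal.mem_comap]
      have : Subring.inclusion hRR ⟨theta p S f g x m - emb p S f m (g m), sub_mem (theta_mem_realR p S f g x hθ m)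
          (emb_mem_realR p S f g x hθ m (g m))⟩ =
          (⟨emb p S f (m + 1) (x m), emb_mem_realR p S f g x hθ (m + 1) (x m)⟩ : realR p S f g x hθ (m + 1)) *
            ⟨theta p S f g x (m + 1), theta_mem_realR p S f g x hθ (m + 1)⟩ :=
        Subtype.ext (by simp [hθsub])
      rw [this]
      exact Ideal.mul_mem_right _ _ (emb_mem_maximalIdeal_realR p S f g x hθ (m + 1) (hinj (m + 1)) hxm𝔪)
    · intro s hs
      rw [Ideal.mem_comap]
      have : Subring.inclusion hRR ⟨emb p S f m s, emb_mem_realR p S f g x hθ m s⟩ =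
          (⟨emb p S f (m + 1) ⟨(s : L), hle m s.2⟩, emb_mem_realR p S f g x hθ (m + 1) _⟩ :
            realR p S f g x hθ (m + 1)) :=
        Subtype.ext (emb_eq_of_coe_eq p S f rfl)
      rw [this]
      exact emb_mem_maximalIdeal_realR p S f g x hθ (m + 1) (hinj (m + 1))
        (NoEternalChainOne.inclusion_mem_maximalIdeal_of_subringDominates hdom hs)
  have hdomR : SubringDominates (realR p S f g x hθ m) (realR p S f g x hθ (m + 1)) := by
    refine ⟨hRR, fun y hy hyinv => ?_⟩
    by_cases hy0 : y = 0
    · rw [hy0, inv_zero]; exact zero_mem _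
    by_contra hcontra
    have hy𝔪 : (⟨y, hy⟩ : realR p S f g x hθ m) ∈ maximalIdeal (realR p S f g x hθ m) :=
      (mem_maximalIdeal_iff_inv_not_mem _).mpr (Or.inr hcontra)
    have := hle𝔪 hy𝔪
    rw [Ideal.mem_comap, mem_maximalIdeal_iff_inv_not_mem] at this
    rcases this with h | h
    · exact hy0 h
    · exact h hyinv
  exact ⟨inferInstance, ξ, hξ𝔪, fun h => hξ0 (congrArg Subtype.val h), inferInstance, hBl,
    fun z hz => by
      obtain ⟨a, ha, b, hb, -, hbi, hab⟩ := hFr hz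
      exact ⟨a, ha, b, hb, hbi, hab⟩,
    hdomR⟩

end QT

end RadicandChainRealisation

end Summit.ResolutionOfSingularities.ResolutionOfSingularities.Theorems.SwitchingDichotomy

end
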